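import Summits.QuantumAdvantage.AdviceFreeQNC0.ShiftedProducts
import HarnessLib

/-!
# Cell qa-qnc0 (rung F-Q1, route RingFrame, crux α, line `product`): the pair-richness lemma —
# average rooted density bounds residue avoidance LINEARLY — and its rooted-density corollaries

Planner statements HOME/qa-qnc0-p1/Sketch6.lean (TARGET.md §19, "PROVED in prose"), now kernel
theorems.  Let `g : {0,1}ⁿ → 𝔽₂` have degree `≤ d`, `B = {u : g u ≠ 0}`, a residue `r` and a shift
size `ℓ ≢ 0 (mod 3)` with `D := 2d + ℓ`, `2D + 2 ≤ n`, `T := Σ_{j < ⌈n/2⌉ − D} C(n, j)`.  A ROOTED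
UP-PAIR of size `ℓ` is a pair `(u, S)` with `|S| = ℓ`, `S ⊆ zeros u`, `u ∈ B` and `u + 1_S ∈ B`;
`pairs↑_ℓ(B)` is their number (the planner's `pairsUp g ℓ`, kept unfolded here so that the file
declares no definitions; `PairRichnessBound` is closed by `pairRichnessBound` after unfolding it).

* `pairRichnessBound` (`PairRichnessBound`, literally):
  `T · pairs↑_ℓ(B) ≤ 2^{n+1} · Σ_{x ∈ B ∩ L_r} (C(n − |x|, ℓ) + C(|x|, ℓ))`.
  Proof: sum the one-shift bound `shift_bound` (two-class theorem on the shifted product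
  `g · Π_{i∈S}(1−u_i) · (g∘τ_S)` + home-class pinning, file `ShiftedProducts.lean`) over `S`; a
  pair touching `B ∩ L_r` at its root `x` is one of `C(n − |x|, ℓ)`, at its tip `x` one of
  `C(|x|, ℓ)` (double count).
* `rootedDensity` (`RootedDensity` WITH the hypothesis `2·2^j ≤ #zeros(b)` added — the planner's
  hypothesis-free shape is false at the boundary: `n = 2`, `j = 1`, `d = 1`, `g = 1 + x₀`,
  `b = 00` has `C(2,2) = 1` and no good `2`-subset, `rootedDensity_boundary_witness`):
  `C(z, q) ≤ C(2q, q) · #{good q-subsets of zeros b}`, `q = 2^j > d`, by double counting the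
  `2q`-sets of zeros against `rootedCovering` (Hegedűs's lemma).
* `weakPLDAMSLinear` (`WeakPLDAMSLinear` with the left sum restricted to the points `b` having
  `≥ 2q` zeros, the form that follows from the two lemmas above; the planner's unrestricted left
  sum is not claimed).

These are the cell's statements (qa-qnc0 TARGET.md §19), not in print; the library inputs are the
landed `twoClassAvoidanceExplicit` and `rootedCovering`.  WHAT THIS IS NOT: nothing on the open
branch (β) `LocSparseBalanceLog`, on `LDMAPolylog` or on α; no separation.

## References

* C. Beck, Y. Li, *Represent MOD function by low degree polynomial with unbounded one-sided
  error*, arXiv:1304.0713 (2013), Thm. 3.4 [BeckLi2013].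
* S. Srinivasan, *A robust version of Hegedűs's lemma, with applications*, TheoretiCS 2 (2023),
  Lemma 1.1 [Srinivasan2023].
-/

noncomputable section

namespace Summit.QuantumAdvantage.AdviceFreeQNC0

open Finset
open Literature.Computability.MetaComplexity Literature.Computability.MetaComplexity.Smolensky
open Literature.Computability.MetaComplexity.Hegedus

variable {n : ℕ}

/-! ### The pair-richness bound -/

/-- **`PairRichnessBound` (planner Sketch6 §19.1), literally:** for `ℓ ≢ 0 (mod 3)`,
`2(2d + ℓ) + 2 ≤ n`, `g ∈ lowDeg 𝔽₂ n d` and every `r`,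
`(Σ_{j < ⌈n/2⌉ − 2d − ℓ} C(n,j)) · #{(u,S) : |S| = ℓ, S ⊆ zeros u, g u ≠ 0, g(u + 1_S) ≠ 0} ≤ 2^{n+1} · Σ_{x : g x ≠ 0, |x| ≡ r (3)} (C(n−|x|, ℓ) + C(|x|, ℓ))`.
The cell's statement; engine = the landed two-class theorem (Beck–Li immunity + Keevash–Sudakov)
on the shifted products `g · Π_{i∈S}(1−u_i) · (g∘τ_S)`.
[cite: BeckLi2013, Theorem 3.4] -/
theorem pairRichnessBound :
    ∀ n d ℓ r : ℕ, ℓ % 3 ≠ 0 → 2 * (2 * d + ℓ) + 2 ≤ n → ∀ g : CubeFn (ZMod 2) n,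
      g ∈ lowDeg (ZMod 2) n d →
        (∑ j ∈ range ((n + 1) / 2 - (2 * d + ℓ)), n.choose j) *
          (((Finset.univ : Finset ((Fin n → Bool) × Finset (Fin n))).filter fun p =>
            p.2.card = ℓ ∧ (∀ i ∈ p.2, p.1 i = false) ∧ g p.1 ≠ 0 ∧
              g (fun i => if i ∈ p.2 then true else p.1 i) ≠ 0).card) ≤
          2 ^ (n + 1) * ∑ x ∈ univ.filter (fun x : Fin n → Bool => g x ≠ 0 ∧ wt x % 3 = r % 3),
            ((n - wt x).choose ℓ + (wt x).choose ℓ) := by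
  intro n d ℓ r hℓ hn g hg
  classical
  set T := ∑ j ∈ range ((n + 1) / 2 - (2 * d + ℓ)), n.choose j with hT
  set BL := univ.filter (fun x : Fin n → Bool => g x ≠ 0 ∧ wt x % 3 = r % 3) with hBL
  -- the pair sets: all rooted pairs, the exceptional ones, root-in-`L_r`, tip-in-`L_r`
  set PR := (univ : Finset ((Fin n → Bool) × Finset (Fin n))).filter fun p =>
      p.2.card = ℓ ∧ (∀ i ∈ p.2, p.1 i = false) ∧ g p.1 ≠ 0 ∧
        g (fun i => if i ∈ p.2 then true else p.1 i) ≠ 0 with hPR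
  set EX := (univ : Finset ((Fin n → Bool) × Finset (Fin n))).filter fun p =>
      (p.2.card = ℓ ∧ (∀ i ∈ p.2, p.1 i = false) ∧ g p.1 ≠ 0 ∧
        g (fun i => if i ∈ p.2 then true else p.1 i) ≠ 0) ∧
      (wt p.1 % 3 = r % 3 ∨ (wt p.1 + ℓ) % 3 = r % 3) with hEX
  set EX1 := (univ : Finset ((Fin n → Bool) × Finset (Fin n))).filter fun p =>
      (g p.1 ≠ 0 ∧ wt p.1 % 3 = r % 3) ∧ (p.2.card = ℓ ∧ ∀ i ∈ p.2, p.1 i = false) with hEX1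
  set EX2 := (univ : Finset ((Fin n → Bool) × Finset (Fin n))).filter fun p =>
      (p.2.card = ℓ ∧ (∀ i ∈ p.2, p.1 i = false) ∧ g p.1 ≠ 0 ∧
        g (fun i => if i ∈ p.2 then true else p.1 i) ≠ 0) ∧
      (wt p.1 + ℓ) % 3 = r % 3 with hEX2
  set EX2' := (univ : Finset ((Fin n → Bool) × Finset (Fin n))).filter fun p =>
      (g p.1 ≠ 0 ∧ wt p.1 % 3 = r % 3) ∧ (p.2.card = ℓ ∧ ∀ i ∈ p.2, p.1 i = true) with hEX2'
  -- (a) `T · #PR ≤ 2^{n+1} · #EX`, shift by shift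
  have hstepS : ∀ S : Finset (Fin n), T * (PR.filter fun p => p.2 = S).card ≤
      2 ^ (n + 1) * (EX.filter fun p => p.2 = S).card := by
    intro S
    by_cases hS : S.card = ℓ
    · have hB : (PR.filter fun p => p.2 = S).card =
          (univ.filter fun u : Fin n → Bool =>
            (∀ i ∈ S, u i = false) ∧ g u ≠ 0 ∧ g (fun i => if i ∈ S then true else u i) ≠ 0).card := by
        refine card_fibre_snd_eq PR S _ fun u => ?_
        rw [hPR, Finset.mem_filter, Finset.mem_filter]
        simp only [Finset.mem_univ, true_and]
        exact ⟨fun h => h.2, fun h => ⟨hS, h⟩⟩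
      have hE : (EX.filter fun p => p.2 = S).card =
          (univ.filter fun u : Fin n → Bool =>
            ((∀ i ∈ S, u i = false) ∧ g u ≠ 0 ∧ g (fun i => if i ∈ S then true else u i) ≠ 0) ∧
            (wt u % 3 = r % 3 ∨ (wt u + ℓ) % 3 = r % 3)).card := by
        refine card_fibre_snd_eq EX S _ fun u => ?_
        rw [hEX, Finset.mem_filter, Finset.mem_filter]
        simp only [Finset.mem_univ, true_and]
        exact ⟨fun h => ⟨h.1.2, h.2⟩, fun h => ⟨⟨hS, h.1⟩, h.2⟩⟩
      rw [hB, hE]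
      exact shift_bound hℓ hn hg hS
    · have hB : (PR.filter fun p => p.2 = S) = ∅ := by
        refine Finset.filter_eq_empty_iff.2 fun p hp h => hS ?_
        rw [hPR, Finset.mem_filter] at hp
        rw [← h]
        exact hp.2.1
      rw [hB, Finset.card_empty, Nat.mul_zero]
      exact Nat.zero_le _
  have ha : T * PR.card ≤ 2 ^ (n + 1) * EX.card := by
    rw [card_eq_sum_card_fibre_snd PR, card_eq_sum_card_fibre_snd EX, Finset.mul_sum,
      Finset.mul_sum]
    exact Finset.sum_le_sum fun S _ => hstepS S
  -- (b) `#EX ≤ #EX1 + #EX2`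
  have hb : EX.card ≤ EX1.card + EX2.card := by
    calc EX.card ≤ (EX1 ∪ EX2).card := by
          refine Finset.card_le_card fun p hp => ?_
          rw [hEX, Finset.mem_filter] at hp
          rcases hp.2.2 with h | h
          · refine Finset.mem_union_left _ ?_
            rw [hEX1, Finset.mem_filter]
            exact ⟨hp.1, ⟨hp.2.1.2.2.1, h⟩, hp.2.1.1, hp.2.1.2.1⟩
          · refine Finset.mem_union_right _ ?_
            rw [hEX2, Finset.mem_filter]
            exact ⟨hp.1, hp.2.1, h⟩
      _ ≤ EX1.card + EX2.card := Finset.card_union_le _ _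
  -- (c) `#EX1 = Σ_{x ∈ B ∩ L_r} C(n − |x|, ℓ)` (root in `L_r`)
  have hc : EX1.card = ∑ x ∈ BL, (n - wt x).choose ℓ := by
    rw [card_eq_sum_card_fibre_fst EX1, hBL, Finset.sum_filter]
    refine Finset.sum_congr rfl fun x _ => ?_
    by_cases hx : g x ≠ 0 ∧ wt x % 3 = r % 3
    · rw [if_pos hx, ← card_subsets_zeros x ℓ]
      refine card_fibre_fst_eq EX1 x _ fun S => ?_
      rw [hEX1, Finset.mem_filter, Finset.mem_filter]
      simp only [Finset.mem_univ, true_and]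
      exact ⟨fun h => h.2, fun h => ⟨hx, h⟩⟩
    · rw [if_neg hx, Finset.card_eq_zero, Finset.filter_eq_empty_iff]
      intro p hp h
      rw [hEX1, Finset.mem_filter] at hp
      rw [← h] at hx
      exact hx hp.2.1
  -- (d) `#EX2 ≤ #EX2' = Σ_{x ∈ B ∩ L_r} C(|x|, ℓ)` (tip in `L_r`; `(u,S) ↦ (u + 1_S, S)` is injective)
  have hd1 : EX2.card ≤ EX2'.card := by
    refine Finset.card_le_card_of_injOn
      (fun p => ((fun i => if i ∈ p.2 then true else p.1 i), p.2))
      (fun p hp => ?_) (fun p hp p' hp' h => ?_)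
    · rw [Finset.mem_coe, hEX2, Finset.mem_filter] at hp
      obtain ⟨-, ⟨hcard, hzero, -, htip⟩, hwt⟩ := hp
      rw [Finset.mem_coe, hEX2', Finset.mem_filter]
      refine ⟨Finset.mem_univ _, ⟨htip, ?_⟩, hcard, fun i hi => ?_⟩
      · change wt (fun i => if i ∈ p.2 then true else p.1 i) % 3 = r % 3
        rw [wt_flip_eq_add hzero, hcard]
        exact hwt
      · change (if i ∈ p.2 then true else p.1 i) = true
        rw [if_pos hi]
    · rw [Finset.mem_coe, hEX2, Finset.mem_filter] at hp hp'
      have h' : ((fun i => if i ∈ p.2 then true else p.1 i), p.2) =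
          ((fun i => if i ∈ p'.2 then true else p'.1 i), p'.2) := h
      have hS : p.2 = p'.2 := (Prod.ext_iff.1 h').2
      have h1 : (fun i => if i ∈ p.2 then true else p.1 i) =
          (fun i => if i ∈ p'.2 then true else p'.1 i) := (Prod.ext_iff.1 h').1
      have hu : p.1 = p'.1 := by
        funext i
        have hi := congrFun h1 i
        change (if i ∈ p.2 then true else p.1 i) = (if i ∈ p'.2 then true else p'.1 i) at hi
        by_cases hiS : i ∈ p.2
        · rw [hp.2.1.2.1 i hiS, hp'.2.1.2.1 i (hS ▸ hiS)]
        · have hiS' : i ∉ p'.2 := hS ▸ hiS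
          rwa [if_neg hiS, if_neg hiS'] at hi
      exact Prod.ext hu hS
  have hd2 : EX2'.card = ∑ x ∈ BL, (wt x).choose ℓ := by
    rw [card_eq_sum_card_fibre_fst EX2', hBL, Finset.sum_filter]
    refine Finset.sum_congr rfl fun x _ => ?_
    by_cases hx : g x ≠ 0 ∧ wt x % 3 = r % 3
    · rw [if_pos hx, ← card_subsets_ones x ℓ]
      refine card_fibre_fst_eq EX2' x _ fun S => ?_
      rw [hEX2', Finset.mem_filter, Finset.mem_filter]
      simp only [Finset.mem_univ, true_and]
      exact ⟨fun h => h.2, fun h => ⟨hx, h⟩⟩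
    · rw [if_neg hx, Finset.card_eq_zero, Finset.filter_eq_empty_iff]
      intro p hp h
      rw [hEX2', Finset.mem_filter] at hp
      rw [← h] at hx
      exact hx hp.2.1
  -- assemble
  calc T * PR.card ≤ 2 ^ (n + 1) * EX.card := ha
    _ ≤ 2 ^ (n + 1) * (EX1.card + EX2'.card) :=
        Nat.mul_le_mul_left _ (hb.trans (Nat.add_le_add_left hd1 _))
    _ = 2 ^ (n + 1) * ∑ x ∈ BL, ((n - wt x).choose ℓ + (wt x).choose ℓ) := by
        rw [hc, hd2, ← Finset.sum_add_distrib]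

/-! ### Rooted density (LYM averaging of `rootedCovering`) -/

/-- **`RootedDensity` (planner Sketch6 §19.2), with the hypothesis `2·2^j ≤ #zeros(b)` under which
the planner's double count works:** for `d < q = 2^j`, `g ∈ lowDeg 𝔽₂ n d`, `g b ≠ 0` and `z ≥ 2q`
zeros of `b`, `C(z, q) ≤ C(2q, q) · #{S ⊆ zeros b : |S| = q, g(b + 1_S) ≠ 0}`.  (Every `2q`-set of
zeros contains a good `q`-set by `rootedCovering`, a `q`-set lies in `C(z − q, q)` of them, and
`C(z, 2q)·C(2q, q) = C(z, q)·C(z − q, q)`.)  Without the hypothesis the inequality fails, see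
`rootedDensity_boundary_witness`. [cite: Srinivasan2023, Lemma 1.1 (Hegedűs's lemma)] -/
theorem rootedDensity :
    ∀ n j d : ℕ, d < 2 ^ j → ∀ g : CubeFn (ZMod 2) n, g ∈ lowDeg (ZMod 2) n d →
      ∀ b : Fin n → Bool, g b ≠ 0 → 2 * 2 ^ j ≤ (univ.filter fun i : Fin n => b i = false).card →
        ((univ.filter fun i : Fin n => b i = false).card).choose (2 ^ j) ≤
          (2 * 2 ^ j).choose (2 ^ j) *
            ((univ.filter fun i : Fin n => b i = false).powerset.filter fun S =>
                S.card = 2 ^ j ∧ g (fun i => if i ∈ S then true else b i) ≠ 0).card := by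
  intro n j d hd g hg b hb hz
  classical
  set q := 2 ^ j with hq
  set Z0 := univ.filter fun i : Fin n => b i = false with hZ0
  set z := Z0.card with hzdef
  set Good := Z0.powerset.filter fun S =>
      S.card = q ∧ g (fun i => if i ∈ S then true else b i) ≠ 0 with hGood
  -- double count the pairs `(Z, S)`, `Z` a `2q`-subset of the zeros, `S ⊆ Z` good
  let Pairs := ((Z0.powersetCard (2 * q)) ×ˢ Good).filter fun p => p.2 ⊆ p.1
  -- every `Z` has a good `S`
  have hlow : (Z0.powersetCard (2 * q)).card ≤ Pairs.card := by
    -- choose a good subset for each `Z`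
    have hch : ∀ Z ∈ Z0.powersetCard (2 * q), ∃ S ∈ Good, S ⊆ Z := by
      intro Z hZ
      rw [Finset.mem_powersetCard] at hZ
      obtain ⟨S, hSZ, hSc, hSg⟩ := rootedCovering n j d hd g hg b hb Z
        (fun i hi => (Finset.mem_filter.1 (hZ.1 hi)).2) hZ.2
      exact ⟨S, Finset.mem_filter.2 ⟨Finset.mem_powerset.2 (hSZ.trans hZ.1), hSc, hSg⟩, hSZ⟩
    choose! pick hpick using hch
    calc (Z0.powersetCard (2 * q)).card
        = ((Z0.powersetCard (2 * q)).image fun Z => (Z, pick Z)).card := by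
          rw [Finset.card_image_of_injective _ fun Z Z' h => (Prod.ext_iff.1 h).1]
      _ ≤ Pairs.card := Finset.card_le_card fun p hp => by
          obtain ⟨Z, hZ, rfl⟩ := Finset.mem_image.1 hp
          exact Finset.mem_filter.2 ⟨Finset.mem_product.2 ⟨hZ, (hpick Z hZ).1⟩, (hpick Z hZ).2⟩
  -- every good `S` lies in at most `C(z − q, q)` sets `Z`
  have hupp : Pairs.card ≤ Good.card * (z - q).choose q := by
    have hfib : ∀ S ∈ Good, (Pairs.filter fun p => p.2 = S).card ≤ (z - q).choose q := by
      intro S hS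
      have hSc : S.card = q := (Finset.mem_filter.1 hS).2.1
      have hSZ0 : S ⊆ Z0 := Finset.mem_powerset.1 (Finset.mem_filter.1 hS).1
      -- `Z ↦ Z ∖ S` injects the fibre into the `q`-subsets of `Z0 ∖ S`
      calc (Pairs.filter fun p => p.2 = S).card
          ≤ ((Z0 \ S).powersetCard q).card := by
            refine Finset.card_le_card_of_injOn (fun p => p.1 \ S) (fun p hp => ?_)
              (fun p hp p' hp' h => ?_)
            · rw [Finset.mem_coe, Finset.mem_filter] at hp
              obtain ⟨hp, rfl⟩ := hp
              have hp' := Finset.mem_filter.1 hp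
              have hZ := (Finset.mem_powersetCard.1 (Finset.mem_product.1 hp'.1).1)
              rw [Finset.mem_coe, Finset.mem_powersetCard]
              refine ⟨Finset.sdiff_subset_sdiff hZ.1 le_rfl, ?_⟩
              rw [Finset.card_sdiff_of_subset hp'.2, hZ.2, (Finset.mem_filter.1 hS).2.1]
              omega
            · rw [Finset.mem_coe, Finset.mem_filter] at hp hp'
              have h1 : p.1 = p'.1 := by
                have e1 : p.1 = (p.1 \ S) ∪ S :=
                  (Finset.sdiff_union_of_subset (hp.2 ▸ (Finset.mem_filter.1 hp.1).2)).symm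
                have e2 : p'.1 = (p'.1 \ S) ∪ S :=
                  (Finset.sdiff_union_of_subset (hp'.2 ▸ (Finset.mem_filter.1 hp'.1).2)).symm
                rw [e1, e2]
                exact congrArg (· ∪ S) h
              exact Prod.ext h1 (hp.2.trans hp'.2.symm)
        _ = (z - q).choose q := by
            rw [Finset.card_powersetCard, Finset.card_sdiff_of_subset hSZ0, hSc]
    calc Pairs.card = ∑ S ∈ Good, (Pairs.filter fun p => p.2 = S).card := by
          refine Finset.card_eq_sum_card_fiberwise fun p hp => ?_
          exact (Finset.mem_product.1 (Finset.mem_filter.1 hp).1).2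
      _ ≤ ∑ S ∈ Good, (z - q).choose q := Finset.sum_le_sum hfib
      _ = Good.card * (z - q).choose q := by rw [Finset.sum_const, smul_eq_mul]
  -- `C(z, 2q)·C(2q, q) = C(z, q)·C(z − q, q)` and `C(z − q, q) > 0`
  have hmul : z.choose (2 * q) * (2 * q).choose q = z.choose q * (z - q).choose q := by
    have h := Nat.choose_mul (n := z) (k := 2 * q) (s := q) (by omega)
    rw [h]
    congr 2
    omega
  have hpos : 0 < (z - q).choose q := Nat.choose_pos (by omega)
  rw [Finset.card_powersetCard] at hlow
  have h := Nat.mul_le_mul_right ((2 * q).choose q) (hlow.trans hupp)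
  rw [hmul, Nat.mul_right_comm] at h
  have h' := Nat.le_of_mul_le_mul_right h hpos
  rw [Nat.mul_comm] at h'
  exact h'

/-- The hypothesis `2·2^j ≤ #zeros(b)` in `rootedDensity` cannot be dropped: on `{0,1}²` the
degree-`1` polynomial `1 + x₀` is non-zero at `00`, whose zero set has `C(2,2) = 1` two-subset,
and `g(11) = 0` — so the planner's hypothesis-free `RootedDensity` (Sketch6) fails at
`n = 2, j = 1, d = 1`. [folklore] -/
theorem rootedDensity_boundary_witness :
    ∃ n j d : ℕ, d < 2 ^ j ∧ ∃ g : CubeFn (ZMod 2) n, g ∈ lowDeg (ZMod 2) n d ∧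
      ∃ b : Fin n → Bool, g b ≠ 0 ∧
        ¬ ((univ.filter fun i : Fin n => b i = false).card).choose (2 ^ j) ≤
          (2 * 2 ^ j).choose (2 ^ j) *
            ((univ.filter fun i : Fin n => b i = false).powerset.filter fun S =>
                S.card = 2 ^ j ∧ g (fun i => if i ∈ S then true else b i) ≠ 0).card := by
  classical
  refine ⟨2, 1, 1, by norm_num, 1 + mono (ZMod 2) {0}, ?_, fun _ => false, ?_, ?_⟩
  · exact Submodule.add_mem _ (one_mem_lowDeg 1) (mono_mem_lowDeg (by simp))
  · rw [Pi.add_apply, Pi.one_apply, mono_apply]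
    decide
  · intro h
    have hzero : (univ.filter fun i : Fin 2 => (fun _ : Fin 2 => false) i = false) = univ := by
      ext i; simp
    rw [hzero, Finset.card_univ, Fintype.card_fin] at h
    have hgood : (((univ : Finset (Fin 2)).powerset.filter fun S =>
        S.card = 2 ^ 1 ∧ (1 + mono (ZMod 2) {0}) (fun i => if i ∈ S then true else false) ≠ 0)) = ∅ := by
      refine Finset.filter_eq_empty_iff.2 fun S _ hS => hS.2 ?_
      have hSu : S = univ := Finset.eq_univ_of_card S (by rw [hS.1]; simp)
      rw [hSu, Pi.add_apply, Pi.one_apply, mono_apply]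
      simp only [Finset.mem_univ, if_true, Finset.mem_singleton, forall_eq]
      decide
    rw [hgood, Finset.card_empty, Nat.mul_zero] at h
    exact absurd h (by norm_num)

/-! ### The linear weak PLDAMS bound -/

/-- **`WeakPLDAMSLinear` (planner Sketch6 §19.2 (a)), with the left sum over the points having at
least `2q` zeros** (the form that follows from `pairRichnessBound` + `rootedDensity`; the
planner's unrestricted left sum is not claimed here): for `d < q = 2^j`, `2(2d + q) + 2 ≤ n`,
`g ∈ lowDeg 𝔽₂ n d` and every `r`,
`T · Σ_{b : g b ≠ 0, |b| + 2q ≤ n} C(n − |b|, q) ≤ C(2q, q) · 2^{n+1} · Σ_{x : g x ≠ 0, |x| ≡ r} (C(n−|x|, q) + C(|x|, q))`.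
 -/
theorem weakPLDAMSLinear :
    ∀ n d j r : ℕ, d < 2 ^ j → 2 * (2 * d + 2 ^ j) + 2 ≤ n → ∀ g : CubeFn (ZMod 2) n,
      g ∈ lowDeg (ZMod 2) n d →
        (∑ i ∈ range ((n + 1) / 2 - (2 * d + 2 ^ j)), n.choose i) *
            ∑ b ∈ univ.filter (fun b : Fin n → Bool => g b ≠ 0 ∧ wt b + 2 * 2 ^ j ≤ n),
              (n - wt b).choose (2 ^ j) ≤
          (2 * 2 ^ j).choose (2 ^ j) * (2 ^ (n + 1) *
            ∑ x ∈ univ.filter (fun x : Fin n → Bool => g x ≠ 0 ∧ wt x % 3 = r % 3),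
              ((n - wt x).choose (2 ^ j) + (wt x).choose (2 ^ j))) := by
  intro n d j r hd hn g hg
  classical
  set q := 2 ^ j with hq
  set T := ∑ i ∈ range ((n + 1) / 2 - (2 * d + q)), n.choose i with hT
  have hq3 : q % 3 ≠ 0 := by
    rw [hq]
    clear hn hT hd
    induction j with
    | zero => norm_num
    | succ j ih => rw [pow_succ]; omega
  set PR := (univ : Finset ((Fin n → Bool) × Finset (Fin n))).filter fun p =>
      p.2.card = q ∧ (∀ i ∈ p.2, p.1 i = false) ∧ g p.1 ≠ 0 ∧
        g (fun i => if i ∈ p.2 then true else p.1 i) ≠ 0 with hPR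
  have hPRB : T * PR.card ≤ 2 ^ (n + 1) *
      ∑ x ∈ univ.filter (fun x : Fin n → Bool => g x ≠ 0 ∧ wt x % 3 = r % 3),
        ((n - wt x).choose q + (wt x).choose q) := pairRichnessBound n d q r hq3 hn g hg
  -- `Σ_{b good} C(n − |b|, q) ≤ C(2q, q) · #PR`
  have hsum : ∑ b ∈ univ.filter (fun b : Fin n → Bool => g b ≠ 0 ∧ wt b + 2 * q ≤ n),
        (n - wt b).choose q ≤ (2 * q).choose q * PR.card := by
    rw [card_eq_sum_card_fibre_fst PR, Finset.mul_sum, Finset.sum_filter]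
    refine Finset.sum_le_sum fun b _ => ?_
    by_cases hb : g b ≠ 0 ∧ wt b + 2 * q ≤ n
    · rw [if_pos hb]
      have hz : (univ.filter fun i : Fin n => b i = false).card = n - wt b := by
        have := wt_add_card_false n b; omega
      have hRD := rootedDensity n j d hd g hg b hb.1 (by rw [hz]; omega)
      rw [hz] at hRD
      refine hRD.trans (Nat.mul_le_mul_left _ ?_)
      rw [card_fibre_fst_eq PR b (univ.filter fun S : Finset (Fin n) =>
          S.card = q ∧ (∀ i ∈ S, b i = false) ∧ g (fun i => if i ∈ S then true else b i) ≠ 0)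
        fun S => by
          rw [hPR, Finset.mem_filter, Finset.mem_filter]
          simp only [Finset.mem_univ, true_and]
          exact ⟨fun h => ⟨h.1, h.2.1, h.2.2.2⟩, fun h => ⟨h.1, h.2.1, hb.1, h.2.2⟩⟩]
      refine Finset.card_le_card fun S hS => ?_
      rw [Finset.mem_filter, Finset.mem_powerset] at hS
      rw [Finset.mem_filter]
      refine ⟨Finset.mem_univ S, hS.2.1, fun i hi => ?_, hS.2.2⟩
      exact (Finset.mem_filter.1 (hS.1 hi)).2
    · rw [if_neg hb]
      exact Nat.zero_le _
  calc T * ∑ b ∈ univ.filter (fun b : Fin n → Bool => g b ≠ 0 ∧ wt b + 2 * q ≤ n),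
          (n - wt b).choose q
      ≤ T * ((2 * q).choose q * PR.card) := Nat.mul_le_mul_left _ hsum
    _ = (2 * q).choose q * (T * PR.card) := by ring
    _ ≤ (2 * q).choose q * (2 ^ (n + 1) *
          ∑ x ∈ univ.filter (fun x : Fin n → Bool => g x ≠ 0 ∧ wt x % 3 = r % 3),
            ((n - wt x).choose q + (wt x).choose q)) := Nat.mul_le_mul_left _ hPRB

end Summit.QuantumAdvantage.AdviceFreeQNC0
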